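import Mathlib.Analysis.SpecialFunctions.Pow.Deriv
import Mathlib.Analysis.SpecialFunctions.Pow.Continuity
import Mathlib.Analysis.Convex.Deriv
import HarnessLib

/-!
# K17 (part 1 of 2) — the scalar toolkit of the `q = 4` sharp share: the reduced quartic `F`, the gauge
# `G = F^{1/4}`, the convexity of `u ↦ F(u, 1 − u)^{1/4}` on `[1/3, 2/3]` and the subadditivity of `G` on the sector

search for candidate a priori estimates; no regularity claim.

Pure one- and two-variable real analysis (Mathlib only): §1 `quartF` ((M) monotonicity by an exact difference
identity), §2 `root4` / `quartG`, §3 `segN`, `segPsi` and the wall identity `4NN″ − 3N′² = (3u−1)(2−3u)(80/9)(u²−u+2/3)`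
⇒ `convexOn_segPsi` (second-derivative test), §4 `quartG_add_le` (subadditivity on the eigen-sector by homogeneity).
The tensor side, the sharp gauge and the headline `TopBotEigSplitting 4 (2/9)` are PART 2.

FILEABLE FORM (400-line lint) — PART 1 of 2 of the staged monolith `NoGo/TopBotEigSplitSharpFour.STAGING.lean` beb657c0d374ab98 (518 l.):
this file = its sections before `## 5.` (declarations byte-identical, same order); PART 2 =
`NoGo/TopBotEigSplitSharpFourMain.lean` (the remaining sections and the headline; it imports this file).
search for candidate a priori estimates; no regularity claim.
FILING (prove seat g26, REQUEST #32′ part 1 of 2 (nogo g43 touch 4, HOME INBOX l.4686: two-part pure cut of the certified monolith `TopBotEigSplitSharpFour.STAGING.lean` beb657c0d374ab98 for the 400-line lint; LEAD RULING (θθ) slot #32)): declarations byte-identical to the no-go seat's staged `TopBotEigSplitSharpFourScalar.STAGING.lean` 8711054070893513; additions: this line and 14 one-line `[bookkeeping]` docstrings on undocumented declarations (gate lint.docstring; RULING (ω)).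
-/

noncomputable section

open Set Real

namespace Summit.NavierStokesRegularity.FunctionalMining

namespace TopEig

/-! ## 1. The reduced quartic `F(a,b) = a⁴ + b⁴ − (8/9)(a² − ab + b²)²` -/

/-- `F(a, b) = a⁴ + b⁴ − (8/9)(a² − ab + b²)²` (`= λ⁴ + λ(−·)⁴ − (2/9)‖·‖⁴` at `a = λ(A)`, `b = λ(−A)`
on symmetric trace-free tensors). [ours] -/
def quartF (a b : ℝ) : ℝ := a ^ 4 + b ^ 4 - 8 / 9 * (a ^ 2 - a * b + b ^ 2) ^ 2

/-- The sum-of-products form `9F = (a² − b²)² + 16ab(a − b)² + 10a²b²`. [ours] -/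
theorem quartF_eq (a b : ℝ) :
    quartF a b = ((a ^ 2 - b ^ 2) ^ 2 + 16 * (a * b) * (a - b) ^ 2 + 10 * (a * b) ^ 2) / 9 := by
  unfold quartF; ring

/-- `F` is symmetric. -/
theorem quartF_symm (a b : ℝ) : quartF a b = quartF b a := by unfold quartF; ring

/-- `F ≥ 0` on the closed quadrant. [ours] -/
theorem quartF_nonneg {a b : ℝ} (ha : 0 ≤ a) (hb : 0 ≤ b) : 0 ≤ quartF a b := by
  rw [quartF_eq]; have := mul_nonneg ha hb; positivity

/-- `F` is `4`-homogeneous. -/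
theorem quartF_smul (t a b : ℝ) : quartF (t * a) (t * b) = t ^ 4 * quartF a b := by
  unfold quartF; ring

/-- `F ≤ (a + b)⁴` on the quadrant (`9F ≤ 4(a + b)⁴`). [ours] -/
theorem quartF_le {a b : ℝ} (ha : 0 ≤ a) (hb : 0 ≤ b) : quartF a b ≤ (a + b) ^ 4 := by
  have hab := mul_nonneg ha hb
  have e : (a + b) ^ 4 - quartF a b =
      (8 * a ^ 4 + 8 * b ^ 4 + 20 * (a * b) * (a ^ 2 + b ^ 2) + 78 * (a * b) ^ 2) / 9 := by
    unfold quartF; ring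
  nlinarith [e, sq_nonneg a, sq_nonneg b, pow_nonneg ha 4, pow_nonneg hb 4,
    mul_nonneg hab (add_nonneg (sq_nonneg a) (sq_nonneg b))]

/-- **(M) `F` is non-decreasing in its first variable on the quadrant** — exact difference identity
`9(F(a′,b) − F(a,b)) = (a′ − a)·C` with `C ≥ 0` a sum of products of non-negative terms. [ours] -/
theorem quartF_mono_left {a a' b : ℝ} (ha : 0 ≤ a) (haa' : a ≤ a') (hb : 0 ≤ b) :
    quartF a b ≤ quartF a' b := by
  have ha' : 0 ≤ a' := ha.trans haa'
  set C : ℝ := (a' ^ 3 + a' ^ 2 * a + a' * a ^ 2 + a ^ 3) +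
    8 * b * (2 * (b - 3 * (a' + a) / 4) ^ 2 + (6 * a' ^ 2 + 6 * a ^ 2 + (a' - a) ^ 2) / 8) with hC
  have hCnn : 0 ≤ C := by rw [hC]; positivity
  have e : quartF a' b - quartF a b = (a' - a) * C / 9 := by rw [hC]; unfold quartF; ring
  have : 0 ≤ (a' - a) * C / 9 := by have := sub_nonneg.2 haa'; positivity
  linarith

/-- `F` is non-decreasing in both variables on the quadrant. [ours] -/
theorem quartF_mono {a a' b b' : ℝ} (ha : 0 ≤ a) (hb : 0 ≤ b) (haa' : a ≤ a') (hbb' : b ≤ b') :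
    quartF a b ≤ quartF a' b' :=
  (quartF_mono_left ha haa' hb).trans <| by
    rw [quartF_symm a' b, quartF_symm a' b']
    exact quartF_mono_left hb hbb' (ha.trans haa')

/-! ## 2. The fourth root and the gauge `G = F^{1/4}` -/

/-- `x ↦ x^{1/4}`. [bookkeeping] -/
def root4 (x : ℝ) : ℝ := x ^ (4⁻¹ : ℝ)

/-- `root4 x = x ^ ((4 : ℕ) : ℝ)⁻¹` (exponent as an inverted natural cast). [bookkeeping] -/
theorem root4_eq (x : ℝ) : root4 x = x ^ ((4 : ℕ) : ℝ)⁻¹ := by norm_num [root4]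

/-- `x^{1/4} ≥ 0` for `x ≥ 0`. [bookkeeping] -/
theorem root4_nonneg {x : ℝ} (hx : 0 ≤ x) : 0 ≤ root4 x := rpow_nonneg hx _

/-- `0^{1/4} = 0`. [bookkeeping] -/
theorem root4_zero : root4 0 = 0 := by norm_num [root4]

/-- `(x^{1/4})⁴ = x` for `x ≥ 0`. -/
theorem root4_pow_four {x : ℝ} (hx : 0 ≤ x) : root4 x ^ 4 = x := by
  rw [root4_eq]; exact rpow_inv_natCast_pow hx (by norm_num)

/-- `(t⁴)^{1/4} = t` for `t ≥ 0`. -/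
theorem root4_pow_four' {t : ℝ} (ht : 0 ≤ t) : root4 (t ^ 4) = t := by
  rw [root4_eq]; exact pow_rpow_inv_natCast ht (by norm_num)

/-- `(t⁴·x)^{1/4} = t·x^{1/4}` for `t, x ≥ 0`. -/
theorem root4_mul {t x : ℝ} (ht : 0 ≤ t) (hx : 0 ≤ x) : root4 (t ^ 4 * x) = t * root4 x := by
  have h := root4_pow_four' ht
  unfold root4 at h ⊢
  rw [mul_rpow (pow_nonneg ht 4) hx, h]

/-- `x^{1/4}` is monotone on `[0, ∞)`. -/
theorem root4_mono {x y : ℝ} (hx : 0 ≤ x) (hxy : x ≤ y) : root4 x ≤ root4 y :=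
  rpow_le_rpow hx hxy (by norm_num)

/-- **The gauge `G(a, b) = F(a, b)^{1/4}`.** [ours] -/
def quartG (a b : ℝ) : ℝ := root4 (quartF a b)

/-- `G(a, b) ≥ 0` on the quadrant. [bookkeeping] -/
theorem quartG_nonneg {a b : ℝ} (ha : 0 ≤ a) (hb : 0 ≤ b) : 0 ≤ quartG a b :=
  root4_nonneg (quartF_nonneg ha hb)

/-- `G` is symmetric: `G(a, b) = G(b, a)`. [bookkeeping] -/
theorem quartG_symm (a b : ℝ) : quartG a b = quartG b a := by rw [quartG, quartG, quartF_symm]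

/-- `G(0, 0) = 0`. [bookkeeping] -/
theorem quartG_zero : quartG 0 0 = 0 := by norm_num [quartG, quartF, root4_zero]

/-- `G` is positively `1`-homogeneous. -/
theorem quartG_smul {t a b : ℝ} (ht : 0 ≤ t) (ha : 0 ≤ a) (hb : 0 ≤ b) :
    quartG (t * a) (t * b) = t * quartG a b := by
  rw [quartG, quartG, quartF_smul, root4_mul ht (quartF_nonneg ha hb)]

/-- `G` is non-decreasing in both variables on the quadrant ((M) + monotone fourth root). -/
theorem quartG_mono {a a' b b' : ℝ} (ha : 0 ≤ a) (hb : 0 ≤ b) (haa' : a ≤ a') (hbb' : b ≤ b') :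
    quartG a b ≤ quartG a' b' :=
  root4_mono (quartF_nonneg ha hb) (quartF_mono ha hb haa' hbb')

/-- `G(a, b) ≤ a + b` on the quadrant. -/
theorem quartG_le {a b : ℝ} (ha : 0 ≤ a) (hb : 0 ≤ b) : quartG a b ≤ a + b := by
  have h := root4_mono (quartF_nonneg ha hb) (quartF_le ha hb)
  rwa [root4_pow_four' (add_nonneg ha hb)] at h

/-- `G⁴ = F` on the quadrant. -/
theorem quartG_pow_four {a b : ℝ} (ha : 0 ≤ a) (hb : 0 ≤ b) : quartG a b ^ 4 = quartF a b :=
  root4_pow_four (quartF_nonneg ha hb)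

/-! ## 3. (C) Convexity of `u ↦ F(u, 1 − u)^{1/4}` on `[1/3, 2/3]` (second-derivative test) -/

/-- `N(u) = F(u, 1 − u)`, the density defect along the segment `a + b = 1`. [ours] -/
def segN (u : ℝ) : ℝ := quartF u (1 - u)

/-- Closed form `N(u) = −6u⁴ + 12u³ − (22/3)u² + (4/3)u + 1/9`. -/
theorem segN_eq (u : ℝ) :
    segN u = -6 * u ^ 4 + 12 * u ^ 3 - 22 / 3 * u ^ 2 + 4 / 3 * u + 1 / 9 := by
  unfold segN quartF; ring

/-- `N′` in closed form. -/
def segN1 (u : ℝ) : ℝ := -24 * u ^ 3 + 36 * u ^ 2 - 44 / 3 * u + 4 / 3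

/-- `N″` in closed form. -/
def segN2 (u : ℝ) : ℝ := -72 * u ^ 2 + 72 * u - 44 / 3

/-- `N` is continuous. [bookkeeping] -/
theorem continuous_segN : Continuous segN := by unfold segN quartF; fun_prop

/-- `N' = segN1`. [bookkeeping] -/
theorem hasDerivAt_segN (u : ℝ) : HasDerivAt segN (segN1 u) u := by
  have h : HasDerivAt (fun x : ℝ => -6 * x ^ 4 + 12 * x ^ 3 - 22 / 3 * x ^ 2 + 4 / 3 * x + 1 / 9)
      (-6 * (4 * u ^ 3) + 12 * (3 * u ^ 2) - 22 / 3 * (2 * u) + 4 / 3) u := by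
    simpa using ((((((hasDerivAt_id' u).pow 4).const_mul (-6)).add
      (((hasDerivAt_id' u).pow 3).const_mul 12)).sub (((hasDerivAt_id' u).pow 2).const_mul (22 / 3))).add
      ((hasDerivAt_id' u).const_mul (4 / 3))).add_const (1 / 9)
  have e : (fun x : ℝ => -6 * x ^ 4 + 12 * x ^ 3 - 22 / 3 * x ^ 2 + 4 / 3 * x + 1 / 9) = segN := by
    funext x; rw [segN_eq]
  rw [e] at h
  convert h using 1; simp only [segN1]; ring

/-- `segN1' = segN2`. [bookkeeping] -/
theorem hasDerivAt_segN1 (u : ℝ) : HasDerivAt segN1 (segN2 u) u := by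
  have h : HasDerivAt (fun x : ℝ => -24 * x ^ 3 + 36 * x ^ 2 - 44 / 3 * x + 4 / 3)
      (-24 * (3 * u ^ 2) + 36 * (2 * u) - 44 / 3) u := by
    simpa using (((((hasDerivAt_id' u).pow 3).const_mul (-24)).add
      (((hasDerivAt_id' u).pow 2).const_mul 36)).sub ((hasDerivAt_id' u).const_mul (44 / 3))).add_const
      (4 / 3)
  have e : (fun x : ℝ => -24 * x ^ 3 + 36 * x ^ 2 - 44 / 3 * x + 4 / 3) = segN1 := by
    funext x; rfl
  rw [e] at h
  convert h using 1; simp only [segN2]; ring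

/-- **The wall identity**: `4NN″ − 3N′² = (3u − 1)(2 − 3u)·(80/9)(u² − u + 2/3)` — it vanishes
exactly at the two axisymmetric walls `u = 1/3`, `u = 2/3`. [ours] -/
theorem segN_wall_identity (u : ℝ) :
    4 * segN u * segN2 u - 3 * segN1 u ^ 2 =
      (3 * u - 1) * (2 - 3 * u) * (80 / 9 * (u ^ 2 - u + 2 / 3)) := by
  rw [segN_eq]; unfold segN1 segN2; ring

/-- `4NN″ − 3N′² ≥ 0` on `[1/3, 2/3]`. -/
theorem segN_wall_nonneg {u : ℝ} (hu1 : 1 / 3 ≤ u) (hu2 : u ≤ 2 / 3) :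
    0 ≤ 4 * segN u * segN2 u - 3 * segN1 u ^ 2 := by
  rw [segN_wall_identity]
  have h1 : 0 ≤ 3 * u - 1 := by linarith
  have h2 : 0 ≤ 2 - 3 * u := by linarith
  have h3 : 0 ≤ 80 / 9 * (u ^ 2 - u + 2 / 3) := by nlinarith [sq_nonneg (u - 1 / 2)]
  exact mul_nonneg (mul_nonneg h1 h2) h3

/-- `N > 0` on `[1/3, 2/3]` (indeed `N ≥ 10(u(1 − u))²/9 ≥ 40/729`). -/
theorem segN_pos {u : ℝ} (hu1 : 1 / 3 ≤ u) (hu2 : u ≤ 2 / 3) : 0 < segN u := by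
  rw [segN, quartF_eq]
  have hp : 2 / 9 ≤ u * (1 - u) := by nlinarith
  have h1 : 0 ≤ 16 * (u * (1 - u)) * (u - (1 - u)) ^ 2 := by
    have : 0 ≤ u * (1 - u) := by linarith
    positivity
  nlinarith [sq_nonneg (u ^ 2 - (1 - u) ^ 2), mul_self_nonneg (u * (1 - u))]

/-- `ψ(u) = N(u)^{1/4} = G(u, 1 − u)`. [ours] -/
def segPsi (u : ℝ) : ℝ := segN u ^ (4⁻¹ : ℝ)

/-- `ψ(u) = G(u, 1 − u)` (definitional). [bookkeeping] -/
theorem segPsi_eq_quartG (u : ℝ) : segPsi u = quartG u (1 - u) := rfl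

/-- `ψ′` in closed form on `(1/3, 2/3)`. -/
def segPsi1 (u : ℝ) : ℝ := segN1 u * 4⁻¹ * segN u ^ ((4⁻¹ : ℝ) - 1)

/-- `ψ″` in closed form on `(1/3, 2/3)`. -/
def segPsi2 (u : ℝ) : ℝ :=
  segN2 u * 4⁻¹ * segN u ^ ((4⁻¹ : ℝ) - 1) +
    segN1 u * 4⁻¹ * (segN1 u * ((4⁻¹ : ℝ) - 1) * segN u ^ ((4⁻¹ : ℝ) - 1 - 1))

/-- `ψ' = segPsi1` on `(1/3, 2/3)`. [bookkeeping] -/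
theorem hasDerivAt_segPsi {u : ℝ} (hu : u ∈ Ioo (1 / 3 : ℝ) (2 / 3)) :
    HasDerivAt segPsi (segPsi1 u) u := by
  have hN := segN_pos hu.1.le hu.2.le
  show HasDerivAt (fun y => segN y ^ (4⁻¹ : ℝ)) (segPsi1 u) u
  exact (hasDerivAt_segN u).rpow_const (Or.inl hN.ne')

/-- `segPsi1' = segPsi2` on `(1/3, 2/3)`. [bookkeeping] -/
theorem hasDerivAt_segPsi1 {u : ℝ} (hu : u ∈ Ioo (1 / 3 : ℝ) (2 / 3)) :
    HasDerivAt segPsi1 (segPsi2 u) u := by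
  have hN := segN_pos hu.1.le hu.2.le
  have h1 : HasDerivAt (fun y => segN y ^ ((4⁻¹ : ℝ) - 1))
      (segN1 u * ((4⁻¹ : ℝ) - 1) * segN u ^ ((4⁻¹ : ℝ) - 1 - 1)) u :=
    (hasDerivAt_segN u).rpow_const (Or.inl hN.ne')
  have h2 : HasDerivAt (fun y => segN1 y * 4⁻¹) (segN2 u * 4⁻¹) u :=
    (hasDerivAt_segN1 u).mul_const _
  exact h2.mul h1

/-- `deriv ψ = segPsi1` on `(1/3, 2/3)`. [bookkeeping] -/
theorem deriv_segPsi_eqOn : EqOn (deriv segPsi) segPsi1 (Ioo (1 / 3 : ℝ) (2 / 3)) :=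
  fun _ hu => (hasDerivAt_segPsi hu).deriv

/-- `(deriv ψ)' = segPsi2` on `(1/3, 2/3)`. [bookkeeping] -/
theorem hasDerivAt_deriv_segPsi {u : ℝ} (hu : u ∈ Ioo (1 / 3 : ℝ) (2 / 3)) :
    HasDerivAt (deriv segPsi) (segPsi2 u) u :=
  (hasDerivAt_segPsi1 hu).congr_of_eventuallyEq
    (Filter.eventuallyEq_of_mem (Ioo_mem_nhds hu.1 hu.2) deriv_segPsi_eqOn)

/-- `ψ″ = (1/16)·N^{1/4 − 2}·(4NN″ − 3N′²) ≥ 0` on `(1/3, 2/3)`. -/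
theorem segPsi2_nonneg {u : ℝ} (hu : u ∈ Ioo (1 / 3 : ℝ) (2 / 3)) : 0 ≤ segPsi2 u := by
  have hN := segN_pos hu.1.le hu.2.le
  set E : ℝ := segN u ^ ((4⁻¹ : ℝ) - 1 - 1) with hE
  have hEpos : 0 < E := rpow_pos_of_pos hN _
  have hpow : segN u ^ ((4⁻¹ : ℝ) - 1) = E * segN u := by
    have h := rpow_sub_one hN.ne' ((4⁻¹ : ℝ) - 1)
    rw [hE, h]; field_simp
  have e : segPsi2 u = 16⁻¹ * E * (4 * segN u * segN2 u - 3 * segN1 u ^ 2) := by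
    unfold segPsi2; rw [hpow]; ring
  rw [e]
  exact mul_nonneg (by positivity) (segN_wall_nonneg hu.1.le hu.2.le)

/-- **(C) `ψ = N^{1/4}` is convex on `[1/3, 2/3]`.** [ours; Mathlib `convexOn_of_deriv2_nonneg`] -/
theorem convexOn_segPsi : ConvexOn ℝ (Icc (1 / 3 : ℝ) (2 / 3)) segPsi := by
  have hint : interior (Icc (1 / 3 : ℝ) (2 / 3)) = Ioo (1 / 3) (2 / 3) := interior_Icc
  refine convexOn_of_deriv2_nonneg (convex_Icc _ _) ?_ ?_ ?_ ?_
  · exact (continuous_segN.rpow_const fun x => Or.inr (by norm_num)).continuousOn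
  · rw [hint]; intro x hx
    exact (hasDerivAt_segPsi hx).differentiableAt.differentiableWithinAt
  · rw [hint]; intro x hx
    exact (hasDerivAt_deriv_segPsi hx).differentiableAt.differentiableWithinAt
  · rw [hint]; intro x hx
    rw [Function.iterate_succ_apply', Function.iterate_one, (hasDerivAt_deriv_segPsi hx).deriv]
    exact segPsi2_nonneg hx

/-! ## 4. (H) The sector and the subadditivity of `G` on it -/

/-- On the SECTOR `{a, b ≥ 0, b ≤ 2a, a ≤ 2b}` — where `(λ(A), λ(−A))` of a symmetric trace-free
tensor lives (sorted eigenvalues) — `G(a, b) = (a + b)·ψ(a/(a + b))` with `a/(a + b) ∈ [1/3, 2/3]`.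
[ours] -/
theorem quartG_eq_segPsi {a b : ℝ} (hb2 : b ≤ 2 * a) (ha2 : a ≤ 2 * b) (hs : 0 < a + b) :
    quartG a b = (a + b) * segPsi (a / (a + b)) ∧ a / (a + b) ∈ Icc (1 / 3 : ℝ) (2 / 3) := by
  have hu : a / (a + b) ∈ Icc (1 / 3 : ℝ) (2 / 3) := by
    constructor
    · rw [le_div_iff₀ hs]; linarith
    · rw [div_le_iff₀ hs]; linarith
  refine ⟨?_, hu⟩
  have ea : a = (a + b) * (a / (a + b)) := by field_simp
  have eb : b = (a + b) * (1 - a / (a + b)) := by field_simp; ring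
  rw [segPsi_eq_quartG, ← quartG_smul hs.le (by linarith [hu.1]) (by linarith [hu.2]), ← ea, ← eb]

/-- **(H) `G` is subadditive on the sector** ((C) + positive homogeneity: every ray of the sector
crosses the segment `a + b = 1`, `a ∈ [1/3, 2/3]`). [ours] -/
theorem quartG_add_le {a b a' b' : ℝ} (ha : 0 ≤ a) (hb : 0 ≤ b) (hb2 : b ≤ 2 * a) (ha2 : a ≤ 2 * b)
    (ha' : 0 ≤ a') (hb' : 0 ≤ b') (hb2' : b' ≤ 2 * a') (ha2' : a' ≤ 2 * b') :
    quartG (a + a') (b + b') ≤ quartG a b + quartG a' b' := by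
  rcases (add_nonneg ha hb).eq_or_lt with hs | hs
  · have h0 : a = 0 ∧ b = 0 := ⟨by linarith, by linarith⟩
    rw [h0.1, h0.2, zero_add, zero_add, quartG_zero, zero_add]
  rcases (add_nonneg ha' hb').eq_or_lt with hs' | hs'
  · have h0 : a' = 0 ∧ b' = 0 := ⟨by linarith, by linarith⟩
    rw [h0.1, h0.2, add_zero, add_zero, quartG_zero, add_zero]
  have hT : 0 < a + a' + (b + b') := by linarith
  obtain ⟨e1, hu⟩ := quartG_eq_segPsi hb2 ha2 hs
  obtain ⟨e2, hv⟩ := quartG_eq_segPsi hb2' ha2' hs'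
  obtain ⟨e3, -⟩ := quartG_eq_segPsi (b := b + b') (by linarith) (by linarith) hT
  -- the combined point is the convex combination with weights `(a+b)/T`, `(a'+b')/T`, `T` the total
  have hw : (a + a') / (a + a' + (b + b')) =
      (a + b) / (a + a' + (b + b')) * (a / (a + b)) +
        (a' + b') / (a + a' + (b + b')) * (a' / (a' + b')) := by
    field_simp
  have hconv := convexOn_segPsi.2 hu hv (div_nonneg hs.le hT.le) (div_nonneg hs'.le hT.le)
    (by field_simp; ring)
  simp only [smul_eq_mul] at hconv
  rw [← hw] at hconv
  rw [e1, e2, e3]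
  calc (a + a' + (b + b')) * segPsi ((a + a') / (a + a' + (b + b')))
      ≤ (a + a' + (b + b')) * ((a + b) / (a + a' + (b + b')) * segPsi (a / (a + b)) +
          (a' + b') / (a + a' + (b + b')) * segPsi (a' / (a' + b'))) :=
        mul_le_mul_of_nonneg_left hconv hT.le
    _ = (a + b) * segPsi (a / (a + b)) + (a' + b') * segPsi (a' / (a' + b')) := by
        field_simp

end TopEig

end Summit.NavierStokesRegularity.FunctionalMining
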